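import Summits.AnomalousDissipation.AnomalousDissipation.Theorems.SawtoothPulseCascadeK3LocalisedClosureApproxEnvelopes
import Mathlib.Analysis.SpecificLimits.Normed
import HarnessLib

/-!
# K3loc / ApproxSol58, line `DriftFree` — helper: envelope bookkeeping, part 1 (phases, strain budget, `Jrate`, decay)

Helper file of the lead prover (gen 3) for `ApproxSol58` (stmt-AnomalousDissipation-19688; parent crux K3loc
stmt-AnomalousDissipation-19492).  The interface `DriftFreeApprox.approximateSolution_of_envelopes` (p473374) reduces
`DriftFree.ApproximateSolution` to two scalar inequalities for an `L²` envelope `E` and a Lipschitz envelope `Λ` of the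
linearised response on `[0, T]`, `T = horizon r ν A = tStart (J_r(ν) + A)`.  This file proves that GEOMETRIC-IN-PHASE
envelopes — `E ≤ K₂ν(j+1)M₂^{j+1}` and `Λ ≤ K₁ν(j+1)M₁^{j+1}` on phase `j`, with `M₂ < r := γ² − 3` and `M₁ < r²` — satisfy
both inequalities for `ν ≤ ν₀(ε, A)` (`envelopeBookkeeping`, in the sequel `…ApproxBookkeeping`; the statement of stub S3
`stub_envelopeBookkeeping` of the lead's reshaped skeleton `linear-response-lip` for 19688).  This part: the tools.

* §D1 phases: every `t ∈ [0,1)` lies in some phase `[tStart j, tStart (j+1)]`, and a phase meeting `[0, tStart m]` has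
  index `≤ m`;
* §D2 strain budget of the carrier: `∫ₛᵗ rateH i ≤ γ`, `∫ₛᵗ rateV i ≤ γ` on any interval, hence
  `∫ₛᵗ ½Σᵢ(rateH i + rateV i) ≤ γ·(jₜ + 2 − jₛ)` (only the phases between those of `s` and `t` are alive);
* §D3 the threshold phase `J = Jrate r ν = ⌈log(1/ν)/(2 log r)⌉₊`: `ν·(r²)^{J−1} < 1` and `N ≤ J` once `ν ≤ (r²)^{-N}`;
* §D4 geometric decay beats polynomial growth: `c (n+a)^k qⁿ ≤ ε` for `n ≥ N(ε)` when `0 ≤ q < 1`;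
* §D5 assembly: `∫₀ᵀ E² ≤ K₂²ν²(J+A+1)²M₂'^{2(J+A+1)} ≤ εν` and
  `∫₀ᵗ e^{∫ₛᵗ(½Σrate+Λ)} ΛE ≤ e·K₁K₂ν²(J+A+1)² X^{J+A+3} ≤ √(εν)`, `X = max(e^γ, M₁M₂, 1) < r³` (`e^γ ≤ e^8 < r³ = (γ²−3)³`
  on `[5,8]`), using `ν < (r²)^{-(J−1)}`.
-/

-- `Summit.<Summit>.<Problem>`: single-conjunct summit, the duplicate namespace segment is deliberate.
set_option linter.dupNamespace false

noncomputable section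

namespace Summit.AnomalousDissipation.AnomalousDissipation.Theorems.SawtoothPulseCascade.DriftFreeApprox

open MeasureTheory Set Filter Topology
open Literature.Analysis Literature.Analysis.FunctionSpaces Literature.Analysis.FluidPDE
open Literature.Analysis.FluidPDE.SawtoothCascade
open Literature.Analysis.FluidPDE.SawtoothCascade.DriftFree

/-! ## §D1 Phases -/

/-- Every `t ∈ [0,1)` lies in some (closed) phase window `[tStart j, tStart (j+1)]`. [folklore] -/
theorem exists_phase_Icc {t : ℝ} (ht : t ∈ Ico (0 : ℝ) 1) :
    ∃ j : ℕ, t ∈ Icc (CascadeParams.tStart j) (CascadeParams.tStart (j + 1)) := by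
  obtain ⟨j, h | h⟩ := DriftFreeExistence.exists_mem_slot ht
  · exact ⟨j, h.1, h.2.trans (by rw [CascadeParams.tStart_succ]; linarith [CascadeParams.tHalf_pos j])⟩
  · exact ⟨j, le_trans (by linarith [CascadeParams.tHalf_pos j]) h.1, h.2⟩

/-- A phase window containing a time `≤ tStart m` has index `≤ m`. [folklore] -/
theorem phase_le_of_le_tStart {t : ℝ} {j m : ℕ} (hj : t ∈ Icc (CascadeParams.tStart j) (CascadeParams.tStart (j + 1)))
    (ht : t ≤ CascadeParams.tStart m) : j ≤ m := by
  by_contra h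
  have h1 : m + 1 ≤ j := by omega
  have h2 : CascadeParams.tStart (m + 1) ≤ CascadeParams.tStart j := CascadeParams.tStart_strictMono.monotone h1
  have h3 : CascadeParams.tStart m < CascadeParams.tStart (m + 1) := CascadeParams.tStart_strictMono (Nat.lt_succ_self m)
  linarith [hj.1]

/-- Phases are ordered along time: `s ≤ t`, `s` in phase `jₛ`, `t` in phase `jₜ` give `jₛ ≤ jₜ + 1`. [folklore] -/
theorem phase_le_phase_succ {s t : ℝ} {js jt : ℕ} (hs : s ∈ Icc (CascadeParams.tStart js) (CascadeParams.tStart (js + 1)))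
    (hjt : t ∈ Icc (CascadeParams.tStart jt) (CascadeParams.tStart (jt + 1))) (hst : s ≤ t) : js ≤ jt + 1 :=
  phase_le_of_le_tStart hs (hst.trans hjt.2)

/-! ## §D2 The strain budget of the carrier on arbitrary intervals -/

section Rates

variable (P : CascadeParams)

/-- `rateH i` has compact support (inside its slot). [folklore] -/
theorem hasCompactSupport_rateH (i : ℕ) : HasCompactSupport (P.rateH i) := by
  refine HasCompactSupport.intro (isCompact_Icc (a := CascadeParams.tStart i)
    (b := CascadeParams.tStart i + CascadeParams.tHalf i)) fun x hx => ?_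
  rcases lt_or_ge x (CascadeParams.tStart i) with h | h
  · exact P.rateH_of_le_tStart h.le
  · have h2 : CascadeParams.tStart i + CascadeParams.tHalf i < x := by
      by_contra h3; exact hx ⟨h, not_lt.1 h3⟩
    exact P.rateH_of_ge h2.le

/-- `rateV i` has compact support (inside its slot). [folklore] -/
theorem hasCompactSupport_rateV (i : ℕ) : HasCompactSupport (P.rateV i) := by
  refine HasCompactSupport.intro (isCompact_Icc (a := CascadeParams.tStart i + CascadeParams.tHalf i)
    (b := CascadeParams.tStart (i + 1))) fun x hx => ?_
  rcases lt_or_ge x (CascadeParams.tStart i + CascadeParams.tHalf i) with h | h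
  · exact P.rateV_of_le h.le
  · have h2 : CascadeParams.tStart (i + 1) < x := by
      by_contra h3; exact hx ⟨h, not_lt.1 h3⟩
    rw [CascadeParams.tStart_succ] at h2
    exact P.rateV_of_ge h2.le

/-- The total strain of the H pulse `i` over the whole line is `γ`. [folklore] -/
theorem integral_rateH_real (i : ℕ) : ∫ t, P.rateH i t = P.γ := by
  rw [← P.integral_rateH i]
  refine (intervalIntegral.integral_eq_integral_of_support_subset fun x hx => ?_).symm
  refine ⟨lt_of_not_ge fun h => hx (P.rateH_of_le_tStart h), le_of_not_gt fun h => hx (P.rateH_of_ge h.le)⟩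

/-- The total strain of the V pulse `i` over the whole line is `γ`. [folklore] -/
theorem integral_rateV_real (i : ℕ) : ∫ t, P.rateV i t = P.γ := by
  rw [← P.integral_rateV i]
  refine (intervalIntegral.integral_eq_integral_of_support_subset fun x hx => ?_).symm
  refine ⟨lt_of_not_ge fun h => hx (P.rateV_of_le h), le_of_not_gt fun h => hx (P.rateV_of_ge ?_)⟩
  rw [CascadeParams.tStart_succ] at h; exact h.le

variable {P}

/-- On any interval the H pulse `i` delivers strain at most `γ`: `∫ₛᵗ rateH i ≤ γ` (`s ≤ t`, `γ ≥ 0`). [folklore] -/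
theorem integral_rateH_le_gamma (hγ : 0 ≤ P.γ) (i : ℕ) {s t : ℝ} (hst : s ≤ t) :
    ∫ τ in s..t, P.rateH i τ ≤ P.γ := by
  have hint : Integrable (P.rateH i) := (P.continuous_rateH i).integrable_of_hasCompactSupport (hasCompactSupport_rateH P i)
  rw [intervalIntegral.integral_of_le hst, ← integral_rateH_real P i]
  exact setIntegral_le_integral hint (Eventually.of_forall fun τ => P.rateH_nonneg hγ i τ)

/-- On any interval the V pulse `i` delivers strain at most `γ`. [folklore] -/
theorem integral_rateV_le_gamma (hγ : 0 ≤ P.γ) (i : ℕ) {s t : ℝ} (hst : s ≤ t) :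
    ∫ τ in s..t, P.rateV i τ ≤ P.γ := by
  have hint : Integrable (P.rateV i) := (P.continuous_rateV i).integrable_of_hasCompactSupport (hasCompactSupport_rateV P i)
  rw [intervalIntegral.integral_of_le hst, ← integral_rateV_real P i]
  exact setIntegral_le_integral hint (Eventually.of_forall fun τ => P.rateV_nonneg hγ i τ)

/-- Between a time `s` in phase `jₛ` and a later time `t` in phase `jₜ` only the phases `jₛ ≤ i ≤ jₜ + 1` are alive:
the rate sum is a finite sum there. [folklore] -/
theorem tsum_rate_eq_sum_Ico {s t τ : ℝ} {js jt : ℕ} (hs : s ∈ Icc (CascadeParams.tStart js) (CascadeParams.tStart (js + 1)))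
    (hjt : t ∈ Icc (CascadeParams.tStart jt) (CascadeParams.tStart (jt + 1))) (hτ : τ ∈ Icc s t) :
    ∑' i, (P.rateH i τ + P.rateV i τ) = ∑ i ∈ Finset.Ico js (jt + 2), (P.rateH i τ + P.rateV i τ) := by
  have hτlt : τ < CascadeParams.tStart (jt + 2) :=
    lt_of_le_of_lt (hτ.2.trans hjt.2) (CascadeParams.tStart_strictMono (by omega))
  rw [tsum_rate_eq_sum_of_lt P hτlt]
  symm
  refine Finset.sum_subset (fun i hi => Finset.mem_range.2 (Finset.mem_Ico.1 hi).2) fun i hi hi' => ?_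
  have hilt : i < js := by
    have := Finset.mem_range.1 hi
    by_contra h; exact hi' (Finset.mem_Ico.2 ⟨not_lt.1 h, this⟩)
  have h1 : CascadeParams.tStart (i + 1) ≤ τ :=
    (CascadeParams.tStart_strictMono.monotone (by omega : i + 1 ≤ js)).trans (hs.1.trans hτ.1)
  rw [CascadeParams.tStart_succ] at h1
  rw [P.rateH_of_ge (by linarith [CascadeParams.tHalf_pos i]), P.rateV_of_ge h1, add_zero]

/-- **Strain budget between phases**: for `s ≤ t` with `s` in phase `jₛ`, `t` in phase `jₜ` (and `γ ≥ 0`),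
`∫ₛᵗ ½Σᵢ(rateH i + rateV i) ≤ γ·(jₜ + 2 − jₛ)` — each alive phase contributes at most `½(γ + γ)`. [folklore] -/
theorem integral_rate_sum_le (hγ : 0 ≤ P.γ) {s t : ℝ} {js jt : ℕ}
    (hs : s ∈ Icc (CascadeParams.tStart js) (CascadeParams.tStart (js + 1)))
    (hjt : t ∈ Icc (CascadeParams.tStart jt) (CascadeParams.tStart (jt + 1))) (hst : s ≤ t) :
    (∫ τ in s..t, (∑' i, (P.rateH i τ + P.rateV i τ)) / 2) ≤ P.γ * (((jt + 2 - js : ℕ) : ℝ)) := by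
  have heq : (∫ τ in s..t, (∑' i, (P.rateH i τ + P.rateV i τ)) / 2) =
      ∫ τ in s..t, (∑ i ∈ Finset.Ico js (jt + 2), (P.rateH i τ + P.rateV i τ)) / 2 := by
    refine intervalIntegral.integral_congr fun τ hτ => ?_
    rw [uIcc_of_le hst] at hτ
    simp only [tsum_rate_eq_sum_Ico hs hjt hτ]
  have hi : ∀ i ∈ Finset.Ico js (jt + 2), IntervalIntegrable (fun τ => P.rateH i τ + P.rateV i τ) volume s t :=
    fun i _ => ((P.continuous_rateH i).add (P.continuous_rateV i)).intervalIntegrable _ _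
  rw [heq, intervalIntegral.integral_div, intervalIntegral.integral_finsetSum hi]
  have hle : ∀ i ∈ Finset.Ico js (jt + 2), (∫ τ in s..t, (P.rateH i τ + P.rateV i τ)) ≤ P.γ + P.γ := by
    intro i _
    rw [intervalIntegral.integral_add ((P.continuous_rateH i).intervalIntegrable _ _)
      ((P.continuous_rateV i).intervalIntegrable _ _)]
    exact add_le_add (integral_rateH_le_gamma hγ i hst) (integral_rateV_le_gamma hγ i hst)
  calc (∑ i ∈ Finset.Ico js (jt + 2), ∫ τ in s..t, (P.rateH i τ + P.rateV i τ)) / 2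
      ≤ (∑ _i ∈ Finset.Ico js (jt + 2), (P.γ + P.γ)) / 2 :=
        div_le_div_of_nonneg_right (Finset.sum_le_sum hle) zero_le_two
    _ = P.γ * (((jt + 2 - js : ℕ) : ℝ)) := by
        rw [Finset.sum_const, Nat.card_Ico, nsmul_eq_mul]; ring

end Rates

/-! ## §D3 The threshold phase `Jrate` -/

section Jrate

variable {r ν : ℝ}

/-- `ν·(r²)^{J−1} < 1` for `J = Jrate r ν = ⌈log(1/ν)/(2 log r)⌉₊`, `0 < ν < 1`, `1 < r`: the threshold phase is
the first one with `r^{2J} ≥ 1/ν`. [folklore] -/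
theorem nu_mul_pow_Jrate_lt_one (hν : 0 < ν) (hν1 : ν < 1) (hr : 1 < r) :
    ν * (r ^ 2) ^ (Jrate r ν - 1) < 1 := by
  have hlogr : 0 < Real.log r := Real.log_pos hr
  have hx : 0 ≤ Real.log (1 / ν) / (2 * Real.log r) :=
    div_nonneg (Real.log_nonneg (by rw [le_div_iff₀ hν]; linarith)) (by positivity)
  have hJ : ((Jrate r ν : ℕ) : ℝ) < Real.log (1 / ν) / (2 * Real.log r) + 1 := Nat.ceil_lt_add_one hx
  have hJ1 : 1 ≤ Jrate r ν := by
    have : 0 < Real.log (1 / ν) / (2 * Real.log r) :=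
      div_pos (Real.log_pos (by rw [lt_div_iff₀ hν]; linarith)) (by positivity)
    exact Nat.one_le_iff_ne_zero.2 (Nat.pos_iff_ne_zero.1 (Nat.ceil_pos.2 this))
  have hcast : (((Jrate r ν - 1 : ℕ)) : ℝ) = (Jrate r ν : ℝ) - 1 := by
    rw [Nat.cast_sub hJ1, Nat.cast_one]
  have h1 : (((Jrate r ν - 1 : ℕ)) : ℝ) * (2 * Real.log r) < Real.log (1 / ν) := by
    rw [hcast]
    have := (lt_div_iff₀ (by positivity : (0 : ℝ) < 2 * Real.log r)).1 (by linarith : (Jrate r ν : ℝ) - 1 < _)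
    exact this
  have h2 : Real.log ((r ^ 2) ^ (Jrate r ν - 1)) < Real.log (1 / ν) := by
    rw [Real.log_pow, Real.log_pow]; push_cast; nlinarith
  have hpos : 0 < (r ^ 2) ^ (Jrate r ν - 1) := by positivity
  have h3 : (r ^ 2) ^ (Jrate r ν - 1) < 1 / ν := (Real.log_lt_log_iff hpos (by positivity)).1 h2
  rw [lt_div_iff₀ hν] at h3
  linarith

/-- Deep thresholds: if `ν ≤ ((r²)^N)⁻¹` then `N ≤ Jrate r ν` (`1 < r`, `0 < ν`). [folklore] -/
theorem le_Jrate_of_le (hν : 0 < ν) (hr : 1 < r) {N : ℕ} (hνN : ν ≤ ((r ^ 2) ^ N)⁻¹) : N ≤ Jrate r ν := by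
  have hlogr : 0 < Real.log r := Real.log_pos hr
  have hpow : 0 < (r ^ 2) ^ N := by positivity
  have h1 : (r ^ 2) ^ N ≤ 1 / ν := by
    rw [le_div_iff₀ hν]
    have := mul_le_mul_of_nonneg_left hνN hpow.le
    rw [mul_inv_cancel₀ hpow.ne'] at this
    linarith [this]
  have h2 : Real.log ((r ^ 2) ^ N) ≤ Real.log (1 / ν) := Real.log_le_log hpow h1
  rw [Real.log_pow, Real.log_pow] at h2
  have h3 : (N : ℝ) ≤ Real.log (1 / ν) / (2 * Real.log r) := by
    rw [le_div_iff₀ (by positivity)]; push_cast at h2; nlinarith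
  exact_mod_cast h3.trans (Nat.le_ceil _)

end Jrate

/-! ## §D4 Geometric decay beats polynomial growth -/

/-- `c·(n + a)^k·qⁿ ≤ ε` for all large `n` when `0 ≤ q < 1`, `0 ≤ c`, `0 < ε`. [folklore] -/
theorem eventually_const_mul_pow_mul_pow_le {q c : ℝ} (hq : 0 ≤ q) (hq1 : q < 1) (hc : 0 ≤ c) (a k : ℕ) {ε : ℝ}
    (hε : 0 < ε) : ∃ N : ℕ, ∀ n ≥ N, c * (((n + a : ℕ)) : ℝ) ^ k * q ^ n ≤ ε := by
  -- `(n+a)^k ≤ (a+1)^k n^k` for `n ≥ 1`, and `n^k qⁿ → 0`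
  have hlim : Tendsto (fun n : ℕ => c * ((a : ℝ) + 1) ^ k * ((n : ℝ) ^ k * q ^ n)) atTop (𝓝 0) := by
    have h := tendsto_pow_const_mul_const_pow_of_lt_one k hq hq1
    simpa using h.const_mul (c * ((a : ℝ) + 1) ^ k)
  have hev := (hlim.eventually (ge_mem_nhds hε)).and (eventually_ge_atTop 1)
  obtain ⟨N, hN⟩ := hev.exists_forall_of_atTop
  refine ⟨N, fun n hn => ?_⟩
  obtain ⟨h1, hn1⟩ := hN n hn
  have hna : (((n + a : ℕ)) : ℝ) ≤ ((a : ℝ) + 1) * n := by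
    push_cast
    have : (1 : ℝ) ≤ n := by exact_mod_cast hn1
    nlinarith [(Nat.cast_nonneg a : (0 : ℝ) ≤ a)]
  have hpow : (((n + a : ℕ)) : ℝ) ^ k ≤ (((a : ℝ) + 1) * n) ^ k :=
    pow_le_pow_left₀ (by positivity) hna k
  calc c * (((n + a : ℕ)) : ℝ) ^ k * q ^ n ≤ c * ((((a : ℝ) + 1) * n) ^ k) * q ^ n := by
        gcongr
    _ = c * ((a : ℝ) + 1) ^ k * ((n : ℝ) ^ k * q ^ n) := by rw [mul_pow]; ring
    _ ≤ ε := h1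


/-- One threshold of `Jrate`: `1 ≤ Jrate r ν` for `0 < ν < 1 < r`. [folklore] -/
theorem one_le_Jrate {r ν : ℝ} (hν : 0 < ν) (hν1 : ν < 1) (hr : 1 < r) : 1 ≤ Jrate r ν := by
  have : 0 < Real.log (1 / ν) / (2 * Real.log r) :=
    div_pos (Real.log_pos (by rw [lt_div_iff₀ hν]; linarith)) (by positivity [Real.log_pos hr])
  exact Nat.one_le_iff_ne_zero.2 (Nat.pos_iff_ne_zero.1 (Nat.ceil_pos.2 this))

/-- Trading the viscosity against a geometric factor: if `ν ρⁿ ≤ 1` then `νᵐ Y^{n+c} ≤ Y^c (Y/ρᵐ)ⁿ`. [folklore] -/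
theorem pow_mul_pow_le_of_mul_pow_le_one {ν ρ Y : ℝ} (m n c : ℕ) (hρ : 0 < ρ) (hY : 0 ≤ Y) (hν : 0 ≤ ν)
    (h : ν * ρ ^ n ≤ 1) : ν ^ m * Y ^ (n + c) ≤ Y ^ c * (Y / ρ ^ m) ^ n := by
  have hρm : 0 < ρ ^ m := pow_pos hρ m
  have h1 : Y ^ n = (ρ ^ m) ^ n * (Y / ρ ^ m) ^ n := by
    rw [← mul_pow, mul_div_cancel₀ _ hρm.ne']
  have h2 : ν ^ m * (ρ ^ m) ^ n ≤ 1 := by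
    rw [← pow_mul, mul_comm m n, pow_mul, ← mul_pow]
    exact pow_le_one₀ (mul_nonneg hν (pow_nonneg hρ.le n)) h
  have h3 : 0 ≤ Y ^ c * (Y / ρ ^ m) ^ n := mul_nonneg (pow_nonneg hY c) (pow_nonneg (div_nonneg hY hρm.le) n)
  calc ν ^ m * Y ^ (n + c) = (ν ^ m * (ρ ^ m) ^ n) * (Y ^ c * (Y / ρ ^ m) ^ n) := by rw [pow_add, h1]; ring
    _ ≤ 1 * (Y ^ c * (Y / ρ ^ m) ^ n) := mul_le_mul_of_nonneg_right h2 h3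
    _ = Y ^ c * (Y / ρ ^ m) ^ n := one_mul _

/-- `e^γ < (γ² − 3)³` on the box `γ ∈ [5, 8]` (`e^γ ≤ e^8 < 2981 < 22³ ≤ (γ²−3)³`). [folklore] -/
theorem exp_lt_rate_cube {γ : ℝ} (hγ : γ ∈ Icc (5 : ℝ) 8) : Real.exp γ < (γ ^ 2 - 3) ^ 3 := by
  have h1 : Real.exp γ ≤ Real.exp 8 := Real.exp_le_exp.2 hγ.2
  have h2 : Real.exp 8 < 2981 := by
    have h3 : Real.exp 8 = Real.exp 1 ^ 8 := by rw [← Real.exp_nat_mul]; norm_num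
    rw [h3]
    have h4 := Real.exp_one_lt_d9
    have h5 : 0 < Real.exp 1 := Real.exp_pos 1
    calc Real.exp 1 ^ 8 < (2.7182818286 : ℝ) ^ 8 := pow_lt_pow_left₀ h4 h5.le (by norm_num)
      _ < 2981 := by norm_num
  have h6 : (22 : ℝ) ≤ γ ^ 2 - 3 := by nlinarith [hγ.1]
  have h7 : (22 : ℝ) ^ 3 ≤ (γ ^ 2 - 3) ^ 3 := pow_le_pow_left₀ (by norm_num) h6 3
  linarith

end Summit.AnomalousDissipation.AnomalousDissipation.Theorems.SawtoothPulseCascade.DriftFreeApprox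

end
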